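import Literature.Barriers.CriticalPhenomena.PlanarEdwardsModelDiffusiveProofs
import Literature.Barriers.CriticalPhenomena.PlanarEdwardsModelDiffusiveScaledPathFdd
import Mathlib.Analysis.SpecialFunctions.Gaussian.FourierTransform
import Mathlib.MeasureTheory.Integral.IntervalIntegral.Periodic
import Mathlib.Analysis.Real.Pi.Bounds
import HarnessLib

/-!
# The uniform local central limit theorem for the planar simple random walk

Sibling proof file of `…PlanarEdwardsModelDiffusiveProofs` (objects `Edwards2D.StepSeq`,
`Edwards2D.endpoint`, the `±1` sign walks `Fin m → Bool` of the 45° rotation, and the exact/crude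
return probabilities `expect_ite_endpoint_eq_zero_eq_sq`, `expect_ite_endpoint_eq_le`) and of
`…SRWReturnAsymptotics` (`i · P[ω(2i) = 0] → 1/π`). Here the local central limit theorem is proved
**uniformly in space**, in the elementary Fourier form:

* `expect_cos_signSum_sub` — for the `m`-step `±1` walk `S`, `𝔼 cos((S - u)θ) = cos^m θ · cos(uθ)`;
* `expect_ite_signSum_eq_eq_integral` — `P[S_m = u] = (2π)⁻¹ ∫_{-π}^{π} cos^m θ cos(uθ) dθ`, and
  (`…_eq_integral_half`) `= π⁻¹ ∫_{-π/2}^{π/2} cos^m θ cos(uθ) dθ` when `m + u` is even (the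
  integrand is then `π`-periodic); `P[S_m = u] = 0` when `m + u` is odd;
* `abs_sqrt_mul_prob_signSum_sub_gauss_le` — **uniform 1D local CLT**:
  `|√m · P[S_m = u] - √(2/π) e^{-u²/2m}| ≤ δ_m` for all `u ≡ m (mod 2)`, with
  `δ_m = π⁻¹ ∫ |cos^m(x/√m) 1{|x| ≤ π√m/2} - e^{-x²/2}| dx → 0` (dominated convergence,
  `cos t ≤ e^{-t²/8}` on `|t| ≤ π/2`);
* `expect_rot` — the 45° rotation: for the planar walk, `(ω₀ + ω₁, ω₀ - ω₁)` is a pair of independent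
  `±1` walks, `𝔼 F(ω₀(m) + ω₁(m), ω₀(m) - ω₁(m)) = 𝔼_ε 𝔼_ε' F(S ε, S ε')`; hence
  `P[ω(m) = y] = P[S_m = y₀ + y₁] · P[S_m = y₀ - y₁]` (`expect_ite_endpoint_eq_eq_mul`) and the
  **uniform planar local CLT** `|m · P[ω(m) = y] - (2/π) e^{-|y|²/m}| ≤ δ_m (2√(2/π) + δ_m)` for
  `y₀ + y₁ ≡ m (mod 2)` (`abs_mul_prob_endpoint_sub_gauss_le`), `P[ω(m) = y] = 0` otherwise;
* `expect_exp_neg_mul_signSum_sq` — the Gaussian (Hubbard–Stratonovich) representation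
  `𝔼 e^{-λ S²/2} = (2π)^{-1/2} ∫ cos^m(√λ x) e^{-x²/2} dx` and its limit `(1 + θ)^{-1/2}` when
  `m λ_m → θ` (`tendsto_expect_exp_neg_mul_signSum_sq`).

These are the analytic inputs of the second-moment limits (α₁), (α₂) behind
`Edwards2D.Stoll1989_invariance_of_secondMomentLimits`.

## References

* G. F. Lawler, *Intersections of Random Walks* (1991), §1.2, Theorem 1.2.1 (local central limit
  theorem). [Lawler1991]
* F. Spitzer, *Principles of Random Walk* (2nd ed., 1976), §7, P7.9–P7.10 (the classical source of
  the uniform local limit theorem; not cited in the declarations).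
-/

noncomputable section

open Finset Real MeasureTheory Filter Topology intervalIntegral
open scoped BigOperators

namespace Literature.Barriers.CriticalPhenomena

namespace Edwards2D

open Literature.Probability.LatticeModels Literature.Probability.Percolation

variable {m : ℕ}

/-! ### The `±1` walk: Fourier representation of the point probabilities -/

/-- First-step decomposition of uniform averages over sign vectors `Fin (m+1) → Bool`. [folklore] -/
theorem expect_boolSeq_succ (F : (Fin (m + 1) → Bool) → ℝ) :
    𝔼 ε : Fin (m + 1) → Bool, F ε =
      𝔼 ε : Fin m → Bool, (2 : ℝ)⁻¹ * (F (Fin.cons true ε) + F (Fin.cons false ε)) := by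
  rw [Finset.expect_eq_sum_div_card, Finset.expect_eq_sum_div_card]
  have h := (Fin.consEquiv (fun _ : Fin (m + 1) => Bool)).sum_comp F
  rw [← h, Fintype.sum_prod_type, Finset.sum_comm]
  simp only [card_univ, Fintype.card_fun, Fintype.card_bool, Fintype.card_fin, Fintype.sum_bool]
  rw [Finset.sum_div, Finset.sum_div]
  refine Finset.sum_congr rfl fun ε _ => ?_
  change (F (Fin.cons true ε) + F (Fin.cons false ε)) / _ = _
  rw [pow_succ]
  push_cast
  ring

/-- The sign sum of `Fin.cons b ε` is `±1 +` the sign sum of `ε`. [folklore] -/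
theorem signSum_cons (b : Bool) (ε : Fin m → Bool) :
    (∑ i : Fin (m + 1), if (Fin.cons b ε : Fin (m + 1) → Bool) i then (1 : ℤ) else -1) =
      (if b then (1 : ℤ) else -1) + ∑ i : Fin m, if ε i then (1 : ℤ) else -1 := by
  rw [Fin.sum_univ_succ]
  simp only [Fin.cons_zero, Fin.cons_succ]

/-- **`𝔼 cos((S - u)θ) = cos^m θ · cos(uθ)`** for the `m`-step `±1` walk `S = Σ εᵢ` (induction on
`m`: `cos(a - θ) + cos(a + θ) = 2 cos a cos θ`). [cite: Lawler1991, §1.2 (characteristic function of the simple walk)] -/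
theorem expect_cos_signSum_sub (m : ℕ) (u : ℤ) (θ : ℝ) :
    𝔼 ε : Fin m → Bool, Real.cos ((((∑ i, if ε i then (1 : ℤ) else -1) : ℤ) - u) * θ) =
      Real.cos θ ^ m * Real.cos (u * θ) := by
  induction m generalizing u with
  | zero =>
      have h0 : ∀ ε : Fin 0 → Bool,
          Real.cos ((((∑ i, if ε i then (1 : ℤ) else -1) : ℤ) - u) * θ) = Real.cos (u * θ) := by
        intro ε
        rw [Finset.univ_eq_empty, Finset.sum_empty, Int.cast_zero, zero_sub, neg_mul, Real.cos_neg]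
      rw [Finset.expect_congr rfl fun ε _ => h0 ε, Finset.expect_const Finset.univ_nonempty,
        pow_zero, one_mul]
  | succ m ih =>
      rw [expect_boolSeq_succ]
      have h1 : ∀ ε : Fin m → Bool,
          Real.cos ((((∑ i : Fin (m + 1), if (Fin.cons true ε : Fin (m + 1) → Bool) i
            then (1 : ℤ) else -1) : ℤ) - u) * θ) =
          Real.cos ((((∑ i : Fin m, if ε i then (1 : ℤ) else -1) : ℤ) - ((u - 1 : ℤ) : ℝ)) * θ) := by
        intro ε; rw [signSum_cons, if_pos rfl]; congr 1; push_cast; ring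
      have h2 : ∀ ε : Fin m → Bool,
          Real.cos ((((∑ i : Fin (m + 1), if (Fin.cons false ε : Fin (m + 1) → Bool) i
            then (1 : ℤ) else -1) : ℤ) - u) * θ) =
          Real.cos ((((∑ i : Fin m, if ε i then (1 : ℤ) else -1) : ℤ) - ((u + 1 : ℤ) : ℝ)) * θ) := by
        intro ε; rw [signSum_cons, if_neg Bool.false_ne_true]; congr 1; push_cast; ring
      simp_rw [h1, h2]
      rw [← Finset.mul_expect, Finset.expect_add_distrib, ih (u - 1), ih (u + 1)]
      push_cast
      rw [show ((u : ℝ) - 1) * θ = u * θ - θ by ring, show ((u : ℝ) + 1) * θ = u * θ + θ by ring,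
        Real.cos_sub, Real.cos_add, pow_succ]
      ring

/-- `∫_{-π}^{π} cos(kθ) dθ = 2π · 𝟙{k = 0}` for an integer `k`. [folklore] -/
theorem integral_cos_int_mul_eq_ite (k : ℤ) :
    ∫ θ in (-π)..π, Real.cos (k * θ) = if k = 0 then 2 * π else 0 := by
  split_ifs with hk
  · subst hk; simp; ring
  · have hk' : (k : ℝ) ≠ 0 := Int.cast_ne_zero.mpr hk
    rw [intervalIntegral.integral_comp_mul_left (fun x => Real.cos x) hk', integral_cos]
    have h1 : Real.sin (k * π) = 0 := Real.sin_int_mul_pi k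
    have h2 : Real.sin (k * -π) = 0 := by rw [mul_neg, Real.sin_neg, h1, neg_zero]
    simp [h1]

/-- **Fourier representation of the point probabilities of the `±1` walk**:
`P[S_m = u] = (2π)⁻¹ ∫_{-π}^{π} cos^m θ cos(uθ) dθ`. [cite: Lawler1991, §1.2, eq. (1.6)] -/
theorem expect_ite_signSum_eq_eq_integral (m : ℕ) (u : ℤ) :
    𝔼 ε : Fin m → Bool, (if (∑ i, if ε i then (1 : ℤ) else -1) = u then (1 : ℝ) else 0) =
      (2 * π)⁻¹ * ∫ θ in (-π)..π, Real.cos θ ^ m * Real.cos (u * θ) := by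
  have hind : ∀ ε : Fin m → Bool, (if (∑ i, if ε i then (1 : ℤ) else -1) = u then (1 : ℝ) else 0) =
      (2 * π)⁻¹ * ∫ θ in (-π)..π,
        Real.cos ((((∑ i, if ε i then (1 : ℤ) else -1) - u : ℤ) : ℝ) * θ) := by
    intro ε
    rw [integral_cos_int_mul_eq_ite ((∑ i, if ε i then (1 : ℤ) else -1) - u)]
    by_cases he : (∑ i, if ε i then (1 : ℤ) else -1) = u
    · rw [if_pos he, if_pos (sub_eq_zero.2 he)]
      field_simp
    · rw [if_neg he, if_neg (sub_ne_zero.2 he), mul_zero]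
  simp_rw [hind]
  rw [← Finset.mul_expect]
  congr 1
  have hsum : ∫ θ in (-π)..π, ∑ ε : Fin m → Bool,
      Real.cos ((((∑ i, if ε i then (1 : ℤ) else -1) - u : ℤ) : ℝ) * θ) =
      ∑ ε : Fin m → Bool, ∫ θ in (-π)..π,
        Real.cos ((((∑ i, if ε i then (1 : ℤ) else -1) - u : ℤ) : ℝ) * θ) :=
    intervalIntegral.integral_finsetSum fun ε _ => Continuous.intervalIntegrable (by fun_prop) _ _
  rw [Finset.expect_eq_sum_div_card, ← hsum, ← intervalIntegral.integral_div]
  refine intervalIntegral.integral_congr fun θ _ => ?_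
  have h := expect_cos_signSum_sub m u θ
  rw [Finset.expect_eq_sum_div_card] at h
  simp only [Finset.sum_div] at h ⊢
  push_cast at h ⊢
  exact h

/-- Parity: the sign sum of `m` signs is `≡ m (mod 2)`, so `P[S_m = u] = 0` unless `m + u` is
even. [folklore] -/
theorem expect_ite_signSum_eq_eq_zero_of_odd {m : ℕ} {u : ℤ} (h : ¬ Even ((m : ℤ) + u)) :
    𝔼 ε : Fin m → Bool, (if (∑ i, if ε i then (1 : ℤ) else -1) = u then (1 : ℝ) else 0) = 0 := by
  refine Finset.expect_eq_zero fun ε _ => if_neg fun hu => h ?_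
  rw [← hu]
  have : ∀ i, Even ((1 : ℤ) + (if ε i then (1 : ℤ) else -1)) := by
    intro i; cases ε i <;> decide
  have hs : Even (∑ i : Fin m, ((1 : ℤ) + (if ε i then (1 : ℤ) else -1))) :=
    Finset.even_sum _ fun i _ => this i
  simpa [Finset.sum_add_distrib] using hs

/-- For `m + u` even the Fourier integrand `cos^m θ cos(uθ)` is `π`-periodic. [folklore] -/
theorem periodic_cos_pow_mul_cos {m : ℕ} {u : ℤ} (h : Even ((m : ℤ) + u)) :
    Function.Periodic (fun θ : ℝ => Real.cos θ ^ m * Real.cos (u * θ)) π := by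
  intro θ
  simp only
  rw [Real.cos_add_pi, neg_pow, show (u : ℝ) * (θ + π) = u * θ + u * π by ring,
    Real.cos_add_int_mul_pi]
  obtain ⟨k, hk⟩ := h
  have hm : ((-1 : ℝ) ^ m) * (-1) ^ u = 1 := by
    rw [← zpow_natCast, ← zpow_add₀ (by norm_num), hk, ← two_mul, zpow_mul]
    norm_num
  calc (-1) ^ m * Real.cos θ ^ m * ((-1) ^ u * Real.cos (↑u * θ))
      = ((-1 : ℝ) ^ m * (-1) ^ u) * (Real.cos θ ^ m * Real.cos (u * θ)) := by ring
    _ = _ := by rw [hm, one_mul]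

/-- **Half-period form**: for `m + u` even,
`P[S_m = u] = π⁻¹ ∫_{-π/2}^{π/2} cos^m θ cos(uθ) dθ`. [cite: Lawler1991, §1.2] -/
theorem expect_ite_signSum_eq_eq_integral_half {m : ℕ} {u : ℤ} (h : Even ((m : ℤ) + u)) :
    𝔼 ε : Fin m → Bool, (if (∑ i, if ε i then (1 : ℤ) else -1) = u then (1 : ℝ) else 0) =
      π⁻¹ * ∫ θ in (-(π / 2))..(π / 2), Real.cos θ ^ m * Real.cos (u * θ) := by
  rw [expect_ite_signSum_eq_eq_integral]
  set f : ℝ → ℝ := fun θ => Real.cos θ ^ m * Real.cos (u * θ) with hf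
  have hper := periodic_cos_pow_mul_cos h
  have hint : ∀ a b : ℝ, IntervalIntegrable f volume a b := fun a b =>
    ((Real.continuous_cos.pow m).mul (Real.continuous_cos.comp
      (continuous_const.mul continuous_id))).intervalIntegrable a b
  have h1 : ∫ θ in (-π)..0, f θ = ∫ θ in (-(π / 2))..(π / 2), f θ := by
    have := hper.intervalIntegral_add_eq (-π) (-(π / 2))
    rw [show -π + π = 0 by ring, show -(π / 2) + π = π / 2 by ring] at this
    exact this
  have h2 : ∫ θ in (0 : ℝ)..π, f θ = ∫ θ in (-(π / 2))..(π / 2), f θ := by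
    have := hper.intervalIntegral_add_eq 0 (-(π / 2))
    rw [zero_add, show -(π / 2) + π = π / 2 by ring] at this
    exact this
  have hsplit : ∫ θ in (-π)..π, f θ = (∫ θ in (-π)..0, f θ) + ∫ θ in (0 : ℝ)..π, f θ :=
    (intervalIntegral.integral_add_adjacent_intervals (hint _ _) (hint _ _)).symm
  change (2 * π)⁻¹ * ∫ θ in (-π)..π, f θ = π⁻¹ * ∫ θ in (-(π / 2))..(π / 2), f θ
  rw [hsplit, h1, h2]
  have hπ : π ≠ 0 := Real.pi_ne_zero
  field_simp
  ring


/-! ### Three analytic lemmas: `cos t ≤ e^{-t²/8}`, `cos^m(c_m x) → e^{-θx²/2}`, Gaussian Fourier -/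

/-- `cos t ≤ e^{-t²/8}` for `|t| ≤ π/2`. [folklore] -/
theorem cos_le_exp_neg_sq_div_eight {t : ℝ} (ht : |t| ≤ π / 2) :
    Real.cos t ≤ Real.exp (-(t ^ 2 / 8)) := by
  have hexp : 1 - t ^ 2 / 8 ≤ Real.exp (-(t ^ 2 / 8)) := by
    have := Real.add_one_le_exp (-(t ^ 2 / 8)); linarith
  rcases le_or_gt |t| 1 with h1 | h1
  · -- Taylor: `cos t ≤ 1 - t²/2 + (5/96) t⁴ ≤ 1 - t²/8`
    have hb := Real.cos_bound h1
    have h4 : |t| ^ 4 ≤ t ^ 2 := by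
      have h2 : |t| ^ 2 ≤ 1 := by nlinarith [abs_nonneg t]
      calc |t| ^ 4 = |t| ^ 2 * |t| ^ 2 := by ring
        _ ≤ |t| ^ 2 * 1 := by gcongr
        _ = t ^ 2 := by rw [mul_one, sq_abs]
    have := (abs_sub_le_iff.1 hb).1
    nlinarith
  · -- `cos t ≤ cos 1 ≤ 5/9 ≤ 1 - π²/32 ≤ 1 - t²/8`
    have hcos : Real.cos t ≤ 5 / 9 := by
      rw [← Real.cos_abs]
      refine (Real.cos_le_cos_of_nonneg_of_le_pi zero_le_one ?_ h1.le).trans Real.cos_one_le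
      linarith [Real.pi_pos]
    have hπ : π ^ 2 < 10 := by nlinarith [Real.pi_lt_d2, Real.pi_pos]
    have ht2 : t ^ 2 ≤ π ^ 2 / 4 := by
      rw [← sq_abs]; nlinarith [abs_nonneg t, Real.pi_pos]
    linarith

/-- **`cos^m(c_m x) → e^{-θx²/2}` when `m c_m² → θ`.** [folklore] -/
theorem tendsto_cos_mul_pow {c : ℕ → ℝ} {θ : ℝ}
    (h : Tendsto (fun m : ℕ => (m : ℝ) * c m ^ 2) atTop (𝓝 θ)) (x : ℝ) :
    Tendsto (fun m : ℕ => Real.cos (c m * x) ^ m) atTop (𝓝 (Real.exp (-(θ * x ^ 2 / 2)))) := by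
  -- `y_m = 1 - cos(c_m x)`, `m y_m → θx²/2`, `m y_m² → 0`
  set y : ℕ → ℕ → ℝ := fun m _ => 1 - Real.cos (c m * x) with hy
  have hc0 : Tendsto (fun m : ℕ => c m ^ 2) atTop (𝓝 0) := by
    have h1 : Tendsto (fun m : ℕ => ((m : ℝ) * c m ^ 2) * (m : ℝ)⁻¹) atTop (𝓝 (θ * 0)) :=
      h.mul tendsto_inv_atTop_nhds_zero_nat
    rw [mul_zero] at h1
    refine h1.congr' ?_
    filter_upwards [eventually_ne_atTop 0] with m hm
    field_simp
  have ha0 : Tendsto (fun m : ℕ => (c m * x) ^ 2) atTop (𝓝 0) := by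
    simpa [mul_pow] using hc0.mul_const (x ^ 2)
  have habs : ∀ᶠ m : ℕ in atTop, |c m * x| ≤ 1 := by
    have := (tendsto_order.1 ha0).2 1 one_pos
    filter_upwards [this] with m hm
    rw [← sq_abs] at hm
    nlinarith [abs_nonneg (c m * x)]
  -- Taylor remainder of `1 - cos`
  have hrem : ∀ᶠ m : ℕ in atTop,
      |(1 - Real.cos (c m * x)) - (c m * x) ^ 2 / 2| ≤ (5 / 96) * ((c m * x) ^ 2) ^ 2 := by
    filter_upwards [habs] with m hm
    have hb := Real.cos_bound hm
    rw [show ((c m * x) ^ 2) ^ 2 = |c m * x| ^ 4 by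
      rw [show |c m * x| ^ 4 = (|c m * x| ^ 2) ^ 2 by ring, sq_abs]]
    calc |(1 - Real.cos (c m * x)) - (c m * x) ^ 2 / 2|
        = |Real.cos (c m * x) - (1 - (c m * x) ^ 2 / 2)| := by
          rw [← abs_neg]; congr 1; ring
      _ ≤ |c m * x| ^ 4 * (5 / 96) := hb
      _ = _ := by ring
  have hsum : Tendsto (fun m : ℕ => ∑ k ∈ range m, y m k) atTop (𝓝 (θ * x ^ 2 / 2)) := by
    simp only [hy, Finset.sum_const, Finset.card_range, nsmul_eq_mul]
    -- `m (1 - cos) = m (cx)²/2 + m · remainder`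
    have h1 : Tendsto (fun m : ℕ => (m : ℝ) * ((c m * x) ^ 2 / 2)) atTop (𝓝 (θ * x ^ 2 / 2)) := by
      have := h.mul_const (x ^ 2 / 2)
      rw [show θ * (x ^ 2 / 2) = θ * x ^ 2 / 2 by ring] at this
      refine this.congr fun m => by ring
    have h2 : Tendsto (fun m : ℕ => (m : ℝ) * ((1 - Real.cos (c m * x)) - (c m * x) ^ 2 / 2))
        atTop (𝓝 0) := by
      rw [tendsto_zero_iff_abs_tendsto_zero]
      have h3 : Tendsto (fun m : ℕ => (5 / 96) * (((m : ℝ) * c m ^ 2) * (c m ^ 2 * x ^ 4)))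
          atTop (𝓝 ((5 / 96) * (θ * (0 * x ^ 4)))) :=
        (h.mul (hc0.mul_const _)).const_mul _
      rw [zero_mul, mul_zero, mul_zero] at h3
      refine squeeze_zero' (Eventually.of_forall fun m => abs_nonneg _) ?_ h3
      filter_upwards [hrem] with m hm
      simp only [Function.comp_apply]
      rw [abs_mul, Nat.abs_cast]
      calc (m : ℝ) * |(1 - Real.cos (c m * x)) - (c m * x) ^ 2 / 2|
          ≤ (m : ℝ) * ((5 / 96) * ((c m * x) ^ 2) ^ 2) := by gcongr
        _ = _ := by ring
    have := h1.add h2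
    rw [add_zero] at this
    refine this.congr fun m => by ring
  have hsq : Tendsto (fun m : ℕ => ∑ k ∈ range m, y m k ^ 2) atTop (𝓝 0) := by
    simp only [hy, Finset.sum_const, Finset.card_range, nsmul_eq_mul]
    -- `0 ≤ 1 - cos a ≤ a²/2`, so `m (1 - cos)² ≤ m a⁴ / 4 → 0`
    have h3 : Tendsto (fun m : ℕ => ((m : ℝ) * c m ^ 2) * (c m ^ 2 * x ^ 4) / 4)
        atTop (𝓝 (θ * (0 * x ^ 4) / 4)) := (h.mul (hc0.mul_const _)).div_const 4
    rw [zero_mul, mul_zero, zero_div] at h3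
    refine squeeze_zero (fun m => by positivity) (fun m => ?_) h3
    have hlo : 0 ≤ 1 - Real.cos (c m * x) := by linarith [Real.cos_le_one (c m * x)]
    have hhi : 1 - Real.cos (c m * x) ≤ (c m * x) ^ 2 / 2 := by
      linarith [Real.one_sub_sq_div_two_le_cos (x := c m * x)]
    calc (m : ℝ) * (1 - Real.cos (c m * x)) ^ 2 ≤ (m : ℝ) * ((c m * x) ^ 2 / 2) ^ 2 := by
          gcongr
      _ = ((m : ℝ) * c m ^ 2) * (c m ^ 2 * x ^ 4) / 4 := by ring
  have hyb : ∀ᶠ m : ℕ in atTop, ∀ k < m, 0 ≤ y m k ∧ y m k ≤ 1 / 2 := by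
    filter_upwards [habs] with m hm k _
    refine ⟨by simp only [hy]; linarith [Real.cos_le_one (c m * x)], ?_⟩
    simp only [hy]
    have h1 : (c m * x) ^ 2 ≤ 1 := by rw [← sq_abs]; nlinarith [abs_nonneg (c m * x)]
    linarith [Real.one_sub_sq_div_two_le_cos (x := c m * x)]
  have key := tendsto_prod_one_sub hyb hsum hsq
  rw [show -(θ * x ^ 2 / 2) = -(θ * x ^ 2 / 2) from rfl]
  refine key.congr fun m => ?_
  simp only [hy, sub_sub_cancel, Finset.prod_const, Finset.card_range]

/-- `cos^m(x/√m) → e^{-x²/2}`. [folklore] -/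
theorem tendsto_cos_div_sqrt_pow (x : ℝ) :
    Tendsto (fun m : ℕ => Real.cos (x / Real.sqrt m) ^ m) atTop (𝓝 (Real.exp (-(x ^ 2 / 2)))) := by
  have h : Tendsto (fun m : ℕ => (m : ℝ) * ((Real.sqrt m)⁻¹) ^ 2) atTop (𝓝 1) := by
    refine tendsto_const_nhds.congr' ?_
    filter_upwards [eventually_gt_atTop 0] with m hm
    have : (0 : ℝ) < m := by exact_mod_cast hm
    rw [inv_pow, Real.sq_sqrt this.le, mul_inv_cancel₀ this.ne']
  have := tendsto_cos_mul_pow h x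
  rw [one_mul] at this
  refine this.congr fun m => ?_
  rw [div_eq_inv_mul, mul_comm]

/-- **Fourier transform of the Gaussian**: `∫ e^{-x²/2} cos(bx) dx = √(2π) e^{-b²/2}`.
[folklore] -/
theorem integral_exp_neg_sq_half_mul_cos (b : ℝ) :
    ∫ x : ℝ, Real.exp (-(x ^ 2 / 2)) * Real.cos (b * x) =
      Real.sqrt (2 * π) * Real.exp (-(b ^ 2 / 2)) := by
  have hb : (0 : ℝ) < ((1 / 2 : ℂ)).re := by norm_num
  have key := fourierIntegral_gaussian hb (b : ℂ)
  -- real parts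
  have hint : Integrable (fun x : ℝ => Complex.exp (Complex.I * b * x) * Complex.exp (-(1 / 2 : ℂ) * x ^ 2)) := by
    have := integrable_cexp_quadratic hb (Complex.I * b) 0
    refine this.congr (ae_of_all _ fun x => ?_)
    simp only [add_zero]
    rw [← Complex.exp_add]; ring_nf
  have hre : ∀ x : ℝ, (Complex.exp (Complex.I * b * x) * Complex.exp (-(1 / 2 : ℂ) * x ^ 2)).re =
      Real.exp (-(x ^ 2 / 2)) * Real.cos (b * x) := by
    intro x
    have h1 : Complex.exp (Complex.I * b * x) = Complex.exp ((b * x : ℝ) * Complex.I) := by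
      congr 1; push_cast; ring
    have h2 : Complex.exp (-(1 / 2 : ℂ) * x ^ 2) = (Real.exp (-(x ^ 2 / 2)) : ℂ) := by
      rw [Complex.ofReal_exp]; congr 1; push_cast; ring
    rw [h1, h2, Complex.exp_mul_I, mul_comm]
    simp only [Complex.mul_re, Complex.ofReal_re, Complex.ofReal_im, Complex.add_re,
      Complex.I_re, Complex.I_im, Complex.cos_ofReal_re, Complex.sin_ofReal_re,
      Complex.sin_ofReal_im]
    ring
  have h3 := integral_re hint
  simp only [RCLike.re_to_complex, hre] at h3
  rw [h3, key]
  -- evaluate the right-hand side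
  have h4 : ((π : ℂ) / (1 / 2 : ℂ)) ^ (1 / 2 : ℂ) = (Real.sqrt (2 * π) : ℂ) := by
    rw [show ((π : ℂ) / (1 / 2 : ℂ)) = ((2 * π : ℝ) : ℂ) by push_cast; ring,
      show (1 / 2 : ℂ) = ((1 / 2 : ℝ) : ℂ) by push_cast; ring,
      ← Complex.ofReal_cpow (by positivity), Real.sqrt_eq_rpow]
  have h5 : Complex.exp (-(b : ℂ) ^ 2 / (4 * (1 / 2 : ℂ))) = (Real.exp (-(b ^ 2 / 2)) : ℂ) := by
    rw [Complex.ofReal_exp]; congr 1; push_cast; ring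
  rw [h4, h5, ← Complex.ofReal_mul, Complex.ofReal_re]


/-! ### The uniform local central limit theorem for the `±1` walk -/

/-- `e^{-x²/2}` is integrable. [folklore] -/
theorem integrable_exp_neg_sq_half : Integrable (fun x : ℝ => Real.exp (-(x ^ 2 / 2))) := by
  refine (integrable_exp_neg_mul_sq (by norm_num : (0 : ℝ) < 1 / 2)).congr (ae_of_all _ fun x => ?_)
  simp only; congr 1; ring

/-- `e^{-x²/8}` is integrable. [folklore] -/
theorem integrable_exp_neg_sq_div_eight : Integrable (fun x : ℝ => Real.exp (-(x ^ 2 / 8))) := by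
  refine (integrable_exp_neg_mul_sq (by norm_num : (0 : ℝ) < 1 / 8)).congr (ae_of_all _ fun x => ?_)
  simp only; congr 1; ring

/-- `√(2/π) = √(2π)/π`. [folklore] -/
theorem sqrt_two_div_pi : Real.sqrt (2 / π) = Real.sqrt (2 * π) * π⁻¹ := by
  have hπ := Real.pi_pos
  rw [show (2 : ℝ) / π = 2 * π / π ^ 2 by field_simp, Real.sqrt_div' _ (sq_nonneg π),
    Real.sqrt_sq hπ.le, div_eq_mul_inv]

/-- **Rescaled Fourier representation**: for `m ≥ 1` and `m + u` even,
`√m · P[S_m = u] = π⁻¹ ∫ cos^m(x/√m) 𝟙{|x| ≤ π√m/2} cos(ux/√m) dx`. [cite: Lawler1991, §1.2, proof of Theorem 1.2.1] -/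
theorem sqrt_mul_expect_ite_signSum_eq (hm : 0 < m) {u : ℤ} (h : Even ((m : ℤ) + u)) :
    Real.sqrt m * 𝔼 ε : Fin m → Bool,
        (if (∑ i, if ε i then (1 : ℤ) else -1) = u then (1 : ℝ) else 0) =
      π⁻¹ * ∫ x : ℝ, Set.indicator (Set.Icc (-(π * Real.sqrt m / 2)) (π * Real.sqrt m / 2))
        (fun x => Real.cos (x / Real.sqrt m) ^ m) x * Real.cos (u * (x / Real.sqrt m)) := by
  rw [expect_ite_signSum_eq_eq_integral_half h]
  set c := Real.sqrt m with hc_def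
  have hc : 0 < c := Real.sqrt_pos.2 (by exact_mod_cast hm)
  have hsub := intervalIntegral.integral_comp_div
    (f := fun θ => Real.cos θ ^ m * Real.cos (u * θ)) (a := -(π * c / 2)) (b := π * c / 2) hc.ne'
  have ha : -(π * c / 2) / c = -(π / 2) := by field_simp
  have hb : π * c / 2 / c = π / 2 := by field_simp
  rw [ha, hb, smul_eq_mul] at hsub
  have hle : -(π * c / 2) ≤ π * c / 2 := by nlinarith [Real.pi_pos]
  have hind : ∀ x : ℝ, Set.indicator (Set.Icc (-(π * c / 2)) (π * c / 2))
      (fun x => Real.cos (x / c) ^ m) x * Real.cos (u * (x / c)) =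
      Set.indicator (Set.Icc (-(π * c / 2)) (π * c / 2))
        (fun x => Real.cos (x / c) ^ m * Real.cos (u * (x / c))) x := fun x => by
    rw [Set.indicator_mul_left]
  simp_rw [hind]
  rw [MeasureTheory.integral_indicator measurableSet_Icc, MeasureTheory.integral_Icc_eq_integral_Ioc,
    ← intervalIntegral.integral_of_le hle, hsub]
  ring

/-- **The local CLT error bound**: for `m ≥ 1` and `m + u` even,
`|√m · P[S_m = u] - √(2/π) e^{-u²/2m}| ≤ π⁻¹ ∫ |cos^m(x/√m) 𝟙{|x| ≤ π√m/2} - e^{-x²/2}| dx`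
— a bound which does not depend on `u`. [cite: Lawler1991, Theorem 1.2.1] -/
theorem abs_sqrt_mul_expect_ite_signSum_sub_le (hm : 0 < m) {u : ℤ} (h : Even ((m : ℤ) + u)) :
    |Real.sqrt m * 𝔼 ε : Fin m → Bool,
        (if (∑ i, if ε i then (1 : ℤ) else -1) = u then (1 : ℝ) else 0) -
      Real.sqrt (2 / π) * Real.exp (-((u : ℝ) ^ 2 / (2 * m)))| ≤
      π⁻¹ * ∫ x : ℝ, |Set.indicator (Set.Icc (-(π * Real.sqrt m / 2)) (π * Real.sqrt m / 2))
        (fun x => Real.cos (x / Real.sqrt m) ^ m) x - Real.exp (-(x ^ 2 / 2))| := by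
  set c := Real.sqrt m with hc_def
  have hc : 0 < c := Real.sqrt_pos.2 (by exact_mod_cast hm)
  set F : ℝ → ℝ := Set.indicator (Set.Icc (-(π * c / 2)) (π * c / 2))
    (fun x => Real.cos (x / c) ^ m) with hF
  set G : ℝ → ℝ := fun x => Real.exp (-(x ^ 2 / 2)) with hG
  -- the Gaussian side as the same kind of integral
  have hgauss : Real.sqrt (2 / π) * Real.exp (-((u : ℝ) ^ 2 / (2 * m))) =
      π⁻¹ * ∫ x : ℝ, G x * Real.cos (u * (x / c)) := by
    have h1 : ∀ x : ℝ, G x * Real.cos (u * (x / c)) = Real.exp (-(x ^ 2 / 2)) * Real.cos (u / c * x) :=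
      fun x => by simp only [hG]; congr 2; ring
    simp_rw [h1]
    rw [integral_exp_neg_sq_half_mul_cos, sqrt_two_div_pi]
    have hm' : (0 : ℝ) < m := by exact_mod_cast hm
    have : ((u : ℝ) / c) ^ 2 / 2 = (u : ℝ) ^ 2 / (2 * m) := by
      rw [div_pow, hc_def, Real.sq_sqrt hm'.le]; field_simp
    rw [this]; ring
  rw [sqrt_mul_expect_ite_signSum_eq hm h, hgauss, ← mul_sub, abs_mul, abs_of_pos (inv_pos.2 Real.pi_pos)]
  refine mul_le_mul_of_nonneg_left ?_ (inv_pos.2 Real.pi_pos).le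
  -- integrability
  have hFc : ∀ x, |F x| ≤ 1 := by
    intro x; simp only [hF, Set.indicator_apply]
    split_ifs
    · rw [abs_pow]; exact pow_le_one₀ (abs_nonneg _) (Real.abs_cos_le_one _)
    · simp
  have hFm : AEStronglyMeasurable F volume := by
    refine (Measurable.indicator ?_ measurableSet_Icc).aestronglyMeasurable
    fun_prop
  have hFint : Integrable (fun x => F x * Real.cos (u * (x / c))) := by
    have : (fun x => F x * Real.cos (u * (x / c))) = Set.indicator (Set.Icc (-(π * c / 2)) (π * c / 2))
        (fun x => Real.cos (x / c) ^ m * Real.cos (u * (x / c))) := by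
      funext x; simp only [hF]; rw [Set.indicator_mul_left]
    rw [this, integrable_indicator_iff measurableSet_Icc]
    exact (Continuous.integrableOn_Icc (by fun_prop))
  have hGint : Integrable (fun x => G x * Real.cos (u * (x / c))) := by
    refine integrable_exp_neg_sq_half.mul_bdd (c := 1)
      (Continuous.aestronglyMeasurable (by fun_prop)) (ae_of_all _ fun x => ?_)
    rw [Real.norm_eq_abs]; exact Real.abs_cos_le_one _
  rw [← integral_sub hFint hGint]
  have hI : Integrable (fun x => |F x - G x|) := by
    have : Integrable (fun x => F x - G x) := by
      refine Integrable.sub ?_ integrable_exp_neg_sq_half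
      rw [hF, integrable_indicator_iff measurableSet_Icc]
      exact (Continuous.integrableOn_Icc (by fun_prop))
    exact this.abs
  calc |∫ x, (F x * Real.cos (u * (x / c)) - G x * Real.cos (u * (x / c)))|
      ≤ ∫ x, |F x * Real.cos (u * (x / c)) - G x * Real.cos (u * (x / c))| :=
        MeasureTheory.abs_integral_le_integral_abs
    _ ≤ ∫ x, |F x - G x| := by
        refine integral_mono_of_nonneg (ae_of_all _ fun x => abs_nonneg _) hI (ae_of_all _ fun x => ?_)
        show |F x * Real.cos (u * (x / c)) - G x * Real.cos (u * (x / c))| ≤ |F x - G x|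
        rw [← sub_mul, abs_mul]
        exact mul_le_of_le_one_right (abs_nonneg _) (Real.abs_cos_le_one _)

/-- **The local CLT error tends to zero**:
`∫ |cos^m(x/√m) 𝟙{|x| ≤ π√m/2} - e^{-x²/2}| dx → 0` (dominated convergence with the bound
`2e^{-x²/8}`, from `cos t ≤ e^{-t²/8}` on `|t| ≤ π/2`). [cite: Lawler1991, Theorem 1.2.1 (proof)] -/
theorem tendsto_integral_abs_cos_pow_indicator_sub_gauss :
    Tendsto (fun m : ℕ => ∫ x : ℝ, |Set.indicator (Set.Icc (-(π * Real.sqrt m / 2)) (π * Real.sqrt m / 2))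
        (fun x => Real.cos (x / Real.sqrt m) ^ m) x - Real.exp (-(x ^ 2 / 2))|) atTop (𝓝 0) := by
  rw [show (0 : ℝ) = ∫ _ : ℝ, (fun _ : ℝ => (0 : ℝ)) (0 : ℝ) by simp]
  refine tendsto_integral_of_dominated_convergence (fun x => 2 * Real.exp (-(x ^ 2 / 8))) ?_ ?_ ?_ ?_
  · intro m
    refine ((Measurable.indicator ?_ measurableSet_Icc).sub ?_).abs.aestronglyMeasurable <;> fun_prop
  · exact integrable_exp_neg_sq_div_eight.const_mul 2
  · intro m
    refine ae_of_all _ fun x => ?_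
    rw [Real.norm_eq_abs, abs_abs]
    have hG : Real.exp (-(x ^ 2 / 2)) ≤ Real.exp (-(x ^ 2 / 8)) :=
      Real.exp_le_exp.2 (by nlinarith [sq_nonneg x])
    have hF : |Set.indicator (Set.Icc (-(π * Real.sqrt m / 2)) (π * Real.sqrt m / 2))
        (fun x => Real.cos (x / Real.sqrt m) ^ m) x| ≤ Real.exp (-(x ^ 2 / 8)) := by
      rw [Set.indicator_apply]
      split_ifs with hx
      · rcases Nat.eq_zero_or_pos m with rfl | hm
        · have h1 : x ≤ 0 := by simpa using hx.2
          have h2 : 0 ≤ x := by simpa using hx.1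
          have hx0 : x = 0 := le_antisymm h1 h2
          subst hx0; simp
        · have hc : 0 < Real.sqrt m := Real.sqrt_pos.2 (by exact_mod_cast hm)
          have ht : |x / Real.sqrt m| ≤ π / 2 := by
            rw [abs_div, abs_of_pos hc, div_le_iff₀ hc]
            rw [Set.mem_Icc] at hx
            refine abs_le.2 ⟨by linarith [hx.1], by linarith [hx.2]⟩
          have hcos0 : 0 ≤ Real.cos (x / Real.sqrt m) :=
            Real.cos_nonneg_of_neg_pi_div_two_le_of_le (abs_le.1 ht).1 (abs_le.1 ht).2
          rw [abs_of_nonneg (pow_nonneg hcos0 _)]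
          calc Real.cos (x / Real.sqrt m) ^ m ≤ Real.exp (-((x / Real.sqrt m) ^ 2 / 8)) ^ m :=
                pow_le_pow_left₀ hcos0 (cos_le_exp_neg_sq_div_eight ht) m
            _ = Real.exp (-(x ^ 2 / 8)) := by
                rw [← Real.exp_nat_mul, div_pow, Real.sq_sqrt (by positivity)]
                congr 1; field_simp
      · simp [Real.exp_nonneg]
    calc |Set.indicator (Set.Icc (-(π * Real.sqrt m / 2)) (π * Real.sqrt m / 2))
          (fun x => Real.cos (x / Real.sqrt m) ^ m) x - Real.exp (-(x ^ 2 / 2))|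
        ≤ |Set.indicator (Set.Icc (-(π * Real.sqrt m / 2)) (π * Real.sqrt m / 2))
          (fun x => Real.cos (x / Real.sqrt m) ^ m) x| + |Real.exp (-(x ^ 2 / 2))| := abs_sub _ _
      _ ≤ Real.exp (-(x ^ 2 / 8)) + Real.exp (-(x ^ 2 / 8)) := by
          rw [abs_of_pos (Real.exp_pos _)]; exact add_le_add hF hG
      _ = 2 * Real.exp (-(x ^ 2 / 8)) := by ring
  · refine ae_of_all _ fun x => ?_
    have hev : ∀ᶠ m : ℕ in atTop, x ∈ Set.Icc (-(π * Real.sqrt m / 2)) (π * Real.sqrt m / 2) := by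
      have hsq : Tendsto (fun m : ℕ => π * Real.sqrt m / 2) atTop atTop := by
        refine Tendsto.atTop_div_const (by norm_num) (Tendsto.const_mul_atTop Real.pi_pos ?_)
        exact Real.tendsto_sqrt_atTop.comp tendsto_natCast_atTop_atTop
      filter_upwards [hsq.eventually_ge_atTop |x|] with m hm
      exact ⟨by linarith [neg_abs_le x], (le_abs_self x).trans hm⟩
    have hlim : Tendsto (fun m : ℕ => Set.indicator (Set.Icc (-(π * Real.sqrt m / 2)) (π * Real.sqrt m / 2))
        (fun x => Real.cos (x / Real.sqrt m) ^ m) x - Real.exp (-(x ^ 2 / 2))) atTop (𝓝 0) := by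
      have h1 := (tendsto_cos_div_sqrt_pow x).sub (tendsto_const_nhds (x := Real.exp (-(x ^ 2 / 2))))
      rw [sub_self] at h1
      refine h1.congr' ?_
      filter_upwards [hev] with m hm
      rw [Set.indicator_of_mem hm]
    simpa using hlim.abs

/-- **Uniform local central limit theorem for the `±1` walk**: for every `δ > 0`, for all large
`m` and *all* `u ≡ m (mod 2)`, `|√m · P[S_m = u] - √(2/π) e^{-u²/2m}| ≤ δ`.
[cite: Lawler1991, Theorem 1.2.1] -/
theorem uniform_lclt_signSum {δ : ℝ} (hδ : 0 < δ) :
    ∀ᶠ m : ℕ in atTop, ∀ u : ℤ, Even ((m : ℤ) + u) →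
      |Real.sqrt m * 𝔼 ε : Fin m → Bool,
          (if (∑ i, if ε i then (1 : ℤ) else -1) = u then (1 : ℝ) else 0) -
        Real.sqrt (2 / π) * Real.exp (-((u : ℝ) ^ 2 / (2 * m)))| ≤ δ := by
  have h := (tendsto_integral_abs_cos_pow_indicator_sub_gauss.const_mul π⁻¹)
  rw [mul_zero] at h
  filter_upwards [(tendsto_order.1 h).2 δ hδ, eventually_gt_atTop 0] with m hm hm0 u hu
  exact (abs_sqrt_mul_expect_ite_signSum_sub_le hm0 hu).trans hm.le


/-! ### The 45° rotation: the planar walk is a pair of independent `±1` walks -/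

/-- **The 45° rotation**: under the uniform measure on `n`-step planar walks, the pair
`(ω₀(m) + ω₁(m), ω₀(m) - ω₁(m))` of rotated endpoint coordinates is distributed as a pair of
independent `m`-step `±1` walks. [cite: Lawler1991, §1.2 (proof of Theorem 1.2.1 for d = 2)] -/
theorem expect_rot (F : ℤ → ℤ → ℝ) :
    𝔼 ω : StepSeq m, F (endpoint ω 0 + endpoint ω 1) (endpoint ω 0 - endpoint ω 1) =
      𝔼 ε : Fin m → Bool, 𝔼 ε' : Fin m → Bool,
        F (∑ i, if ε i then (1 : ℤ) else -1) (∑ i, if ε' i then (1 : ℤ) else -1) := by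
  classical
  let b₁ : Fin 4 → Bool := ![true, false, true, false]
  let b₂ : Fin 4 → Bool := ![true, false, false, true]
  have hσ₁ : ∀ c : Fin 4, stepVec c 0 + stepVec c 1 = if b₁ c then (1 : ℤ) else -1 := by
    intro c; fin_cases c <;> simp [b₁]
  have hσ₂ : ∀ c : Fin 4, stepVec c 0 - stepVec c 1 = if b₂ c then (1 : ℤ) else -1 := by
    intro c; fin_cases c <;> simp [b₂]
  let tab : Bool → Bool → Fin 4 := fun p q => if p then (if q then 0 else 2) else (if q then 3 else 1)
  let e : StepSeq m ≃ (Fin m → Bool) × (Fin m → Bool) :=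
    { toFun := fun ω => (fun i => b₁ (ω i), fun i => b₂ (ω i))
      invFun := fun p => fun i => tab (p.1 i) (p.2 i)
      left_inv := fun ω => by
        funext i
        change tab (b₁ (ω i)) (b₂ (ω i)) = ω i
        generalize ω i = c
        fin_cases c <;> rfl
      right_inv := fun p => by
        ext i
        · change b₁ (tab (p.1 i) (p.2 i)) = p.1 i
          cases p.1 i <;> cases p.2 i <;> rfl
        · change b₂ (tab (p.1 i) (p.2 i)) = p.2 i
          cases p.1 i <;> cases p.2 i <;> rfl }
  set S : (Fin m → Bool) → ℤ := fun ε => ∑ i, if ε i then (1 : ℤ) else -1 with hS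
  have h1 : ∀ ω : StepSeq m, S (e ω).1 = endpoint ω 0 + endpoint ω 1 := by
    intro ω
    simp only [hS, e, Equiv.coe_fn_mk, ← hσ₁, Finset.sum_add_distrib]
    simp [endpoint, Finset.sum_apply]
  have h2 : ∀ ω : StepSeq m, S (e ω).2 = endpoint ω 0 - endpoint ω 1 := by
    intro ω
    simp only [hS, e, Equiv.coe_fn_mk, ← hσ₂, Finset.sum_sub_distrib]
    simp [endpoint, Finset.sum_apply]
  rw [← Finset.expect_product' univ univ (fun ε ε' => F (S ε) (S ε')), Finset.univ_product_univ]
  exact Fintype.expect_equiv e _ _ fun ω => by rw [← h1 ω, ← h2 ω]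

/-- **Exact planar point probabilities as products**:
`P[ω(m) = y] = P[S_m = y₀ + y₁] · P[S_m = y₀ - y₁]`. [cite: Lawler1991, §1.2] -/
theorem expect_ite_endpoint_eq_eq_mul (y : Site 2) :
    𝔼 ω : StepSeq m, (if endpoint ω = y then (1 : ℝ) else 0) =
      (𝔼 ε : Fin m → Bool, if (∑ i, if ε i then (1 : ℤ) else -1) = y 0 + y 1 then (1 : ℝ) else 0) *
        𝔼 ε : Fin m → Bool, if (∑ i, if ε i then (1 : ℤ) else -1) = y 0 - y 1 then (1 : ℝ) else 0 := by
  have hpt : ∀ ω : StepSeq m, (if endpoint ω = y then (1 : ℝ) else 0) =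
      (if endpoint ω 0 + endpoint ω 1 = y 0 + y 1 then (1 : ℝ) else 0) *
        (if endpoint ω 0 - endpoint ω 1 = y 0 - y 1 then (1 : ℝ) else 0) := by
    intro ω
    by_cases h : endpoint ω = y
    · simp [h]
    · rw [if_neg h]
      by_cases h3 : endpoint ω 0 + endpoint ω 1 = y 0 + y 1
      · have h4 : ¬ endpoint ω 0 - endpoint ω 1 = y 0 - y 1 := by
          intro h4
          apply h
          funext k
          fin_cases k
          · show endpoint ω 0 = y 0
            omega
          · show endpoint ω 1 = y 1
            omega
        rw [if_neg h4, mul_zero]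
      · rw [if_neg h3, zero_mul]
  rw [Finset.expect_congr rfl fun ω _ => hpt ω,
    expect_rot (fun a b => (if a = y 0 + y 1 then (1 : ℝ) else 0) * (if b = y 0 - y 1 then (1 : ℝ) else 0)),
    Finset.expect_mul_expect]

/-- Parity in the plane: `P[ω(m) = y] = 0` unless `y₀ + y₁ ≡ m (mod 2)`. [folklore] -/
theorem expect_ite_endpoint_eq_eq_zero_of_odd {y : Site 2} (h : ¬ Even ((m : ℤ) + (y 0 + y 1))) :
    𝔼 ω : StepSeq m, (if endpoint ω = y then (1 : ℝ) else 0) = 0 := by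
  rw [expect_ite_endpoint_eq_eq_mul, expect_ite_signSum_eq_eq_zero_of_odd h, zero_mul]

open Literature.Probability.RandomPlanarGeometry.SAW.Zd (normSq)

/-- **Uniform local central limit theorem for the planar simple random walk**: for every
`δ > 0`, for all large `m` and *all* sites `y` with `y₀ + y₁ ≡ m (mod 2)`,
`|m · P[ω(m) = y] - (2/π) e^{-|y|²/m}| ≤ δ`. [cite: Lawler1991, Theorem 1.2.1] -/
theorem uniform_lclt_endpoint {δ : ℝ} (hδ : 0 < δ) :
    ∀ᶠ m : ℕ in atTop, ∀ y : Site 2, Even ((m : ℤ) + (y 0 + y 1)) →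
      |(m : ℝ) * 𝔼 ω : StepSeq m, (if endpoint ω = y then (1 : ℝ) else 0) -
        2 / π * Real.exp (-(normSq y / m))| ≤ δ := by
  set K : ℝ := Real.sqrt (2 / π) with hK
  have hK0 : 0 ≤ K := Real.sqrt_nonneg _
  have hKK : K * K = 2 / π := Real.mul_self_sqrt (by positivity)
  set δ₁ : ℝ := min 1 (δ / (2 * K + 1)) with hδ₁
  have hδ₁0 : 0 < δ₁ := lt_min one_pos (div_pos hδ (by positivity))
  have hδ₁1 : δ₁ ≤ 1 := min_le_left _ _
  have hδ₁2 : δ₁ * (2 * K + 1) ≤ δ := by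
    have := min_le_right 1 (δ / (2 * K + 1))
    rwa [← hδ₁, le_div_iff₀ (by positivity)] at this
  filter_upwards [uniform_lclt_signSum hδ₁0, eventually_gt_atTop 0] with m hm hm0 y hy
  set u : ℤ := y 0 + y 1 with hu
  set v : ℤ := y 0 - y 1 with hv
  have hv' : Even ((m : ℤ) + v) := by
    have : (m : ℤ) + v = ((m : ℤ) + u) - 2 * y 1 := by rw [hu, hv]; ring
    rw [this]
    exact hy.sub (even_two_mul _)
  set a := Real.sqrt m * 𝔼 ε : Fin m → Bool,
    (if (∑ i, if ε i then (1 : ℤ) else -1) = u then (1 : ℝ) else 0) with ha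
  set b := Real.sqrt m * 𝔼 ε : Fin m → Bool,
    (if (∑ i, if ε i then (1 : ℤ) else -1) = v then (1 : ℝ) else 0) with hb
  set a' := K * Real.exp (-((u : ℝ) ^ 2 / (2 * m))) with ha'
  set b' := K * Real.exp (-((v : ℝ) ^ 2 / (2 * m))) with hb'
  have h1 : |a - a'| ≤ δ₁ := hm u hy
  have h2 : |b - b'| ≤ δ₁ := hm v hv'
  have ha'0 : 0 ≤ a' := by positivity
  have hb'0 : 0 ≤ b' := by positivity
  have ha'K : a' ≤ K := mul_le_of_le_one_right hK0 (Real.exp_le_one_iff.2 (by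
    have : (0 : ℝ) ≤ (u : ℝ) ^ 2 / (2 * m) := by positivity
    linarith))
  have hb'K : b' ≤ K := mul_le_of_le_one_right hK0 (Real.exp_le_one_iff.2 (by
    have : (0 : ℝ) ≤ (v : ℝ) ^ 2 / (2 * m) := by positivity
    linarith))
  have hm' : (0 : ℝ) < m := by exact_mod_cast hm0
  -- the two sides
  have hlhs : (m : ℝ) * 𝔼 ω : StepSeq m, (if endpoint ω = y then (1 : ℝ) else 0) = a * b := by
    rw [expect_ite_endpoint_eq_eq_mul, ha, hb]
    set qu := 𝔼 ε : Fin m → Bool, (if (∑ i, if ε i then (1 : ℤ) else -1) = u then (1 : ℝ) else 0)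
    set qv := 𝔼 ε : Fin m → Bool, (if (∑ i, if ε i then (1 : ℤ) else -1) = v then (1 : ℝ) else 0)
    have hsqm : Real.sqrt m * Real.sqrt m = m := Real.mul_self_sqrt hm'.le
    linear_combination (-(qu * qv)) * hsqm
  have hrhs : 2 / π * Real.exp (-(normSq y / m)) = a' * b' := by
    rw [ha', hb', mul_mul_mul_comm, hKK, ← Real.exp_add]
    congr 1
    have hn : normSq y = ((y 0 : ℝ)) ^ 2 + ((y 1 : ℝ)) ^ 2 := by
      simp [normSq, Fin.sum_univ_two]
    rw [hn, hu, hv]; push_cast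
    field_simp; ring
  rw [hlhs, hrhs]
  have hab : a * b - a' * b' = a * (b - b') + (a - a') * b' := by ring
  have haa : |a| ≤ K + δ₁ := by
    calc |a| = |a' + (a - a')| := by ring_nf
      _ ≤ |a'| + |a - a'| := abs_add_le _ _
      _ ≤ K + δ₁ := add_le_add (by rwa [abs_of_nonneg ha'0]) h1
  calc |a * b - a' * b'| = |a * (b - b') + (a - a') * b'| := by rw [hab]
    _ ≤ |a * (b - b')| + |(a - a') * b'| := abs_add_le _ _
    _ = |a| * |b - b'| + |a - a'| * b' := by rw [abs_mul a, abs_mul (a - a'), abs_of_nonneg hb'0]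
    _ ≤ (K + δ₁) * δ₁ + δ₁ * K := by gcongr
    _ = δ₁ * (2 * K + δ₁) := by ring
    _ ≤ δ₁ * (2 * K + 1) := by gcongr
    _ ≤ δ := hδ₁2

/-! ### The Gaussian representation of `𝔼 e^{-λS²/2}` (Hubbard–Stratonovich) -/

/-- **`𝔼 e^{-λS²/2} = (2π)^{-1/2} ∫ e^{-x²/2} cos^m(√λ x) dx`** for the `m`-step `±1` walk
(`e^{-c²/2} = (2π)^{-1/2} ∫ e^{-x²/2} cos(cx) dx` with `c = √λ S`, and
`𝔼 cos(√λ x S) = cos^m(√λ x)`). [folklore] -/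
theorem expect_exp_neg_mul_signSum_sq (m : ℕ) {lam : ℝ} (hlam : 0 ≤ lam) :
    𝔼 ε : Fin m → Bool, Real.exp (-(lam * (((∑ i, if ε i then (1 : ℤ) else -1) : ℤ) : ℝ) ^ 2 / 2)) =
      (Real.sqrt (2 * π))⁻¹ * ∫ x : ℝ, Real.exp (-(x ^ 2 / 2)) * Real.cos (Real.sqrt lam * x) ^ m := by
  have hsq : (0 : ℝ) < Real.sqrt (2 * π) := Real.sqrt_pos.2 (by positivity)
  have hpt : ∀ ε : Fin m → Bool,
      Real.exp (-(lam * (((∑ i, if ε i then (1 : ℤ) else -1) : ℤ) : ℝ) ^ 2 / 2)) =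
      (Real.sqrt (2 * π))⁻¹ * ∫ x : ℝ, Real.exp (-(x ^ 2 / 2)) *
        Real.cos ((Real.sqrt lam * (((∑ i, if ε i then (1 : ℤ) else -1) : ℤ) : ℝ)) * x) := by
    intro ε
    rw [integral_exp_neg_sq_half_mul_cos, ← mul_assoc, inv_mul_cancel₀ hsq.ne', one_mul, mul_pow,
      Real.sq_sqrt hlam, mul_div_assoc]
  rw [Finset.expect_congr rfl fun ε _ => hpt ε, ← Finset.mul_expect]
  congr 1
  have hint : ∀ ε : Fin m → Bool, Integrable (fun x : ℝ => Real.exp (-(x ^ 2 / 2)) *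
      Real.cos ((Real.sqrt lam * (((∑ i, if ε i then (1 : ℤ) else -1) : ℤ) : ℝ)) * x)) := fun ε =>
    integrable_exp_neg_sq_half.mul_bdd (c := 1) (Continuous.aestronglyMeasurable (by fun_prop))
      (ae_of_all _ fun x => by rw [Real.norm_eq_abs]; exact Real.abs_cos_le_one _)
  rw [Finset.expect_eq_sum_div_card, ← integral_finsetSum _ (fun ε _ => hint ε),
    ← MeasureTheory.integral_div]
  refine integral_congr_ae (ae_of_all _ fun x => ?_)
  simp only
  rw [← Finset.mul_sum, mul_div_assoc, ← Finset.expect_eq_sum_div_card]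
  congr 1
  have h := expect_cos_signSum_sub m 0 (Real.sqrt lam * x)
  rw [Int.cast_zero, zero_mul, Real.cos_zero, mul_one] at h
  rw [← h]
  refine Finset.expect_congr rfl fun ε _ => ?_
  congr 1; push_cast; ring

/-- **`𝔼 e^{-λ_m S_m²/2} → (1 + θ)^{-1/2}` when `m λ_m → θ`** (dominated convergence in the
Gaussian representation: `cos^m(√λ_m x) → e^{-θx²/2}` and
`∫ e^{-(1+θ)x²/2} dx = √(2π/(1+θ))`). [folklore] -/
theorem tendsto_expect_exp_neg_mul_signSum_sq {lam : ℕ → ℝ} {θ : ℝ} (h0 : ∀ m, 0 ≤ lam m)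
    (h : Tendsto (fun m : ℕ => (m : ℝ) * lam m) atTop (𝓝 θ)) :
    Tendsto (fun m : ℕ => 𝔼 ε : Fin m → Bool,
      Real.exp (-(lam m * (((∑ i, if ε i then (1 : ℤ) else -1) : ℤ) : ℝ) ^ 2 / 2))) atTop
      (𝓝 ((Real.sqrt (1 + θ))⁻¹)) := by
  have hθ : 0 ≤ θ := ge_of_tendsto' h fun m => by have := h0 m; positivity
  simp_rw [expect_exp_neg_mul_signSum_sq _ (h0 _)]
  have hsq : (0 : ℝ) < Real.sqrt (2 * π) := Real.sqrt_pos.2 (by positivity)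
  -- the limit integral
  have hval : (Real.sqrt (2 * π))⁻¹ * ∫ x : ℝ, Real.exp (-(x ^ 2 / 2)) * Real.exp (-(θ * x ^ 2 / 2)) =
      (Real.sqrt (1 + θ))⁻¹ := by
    have h1 : ∀ x : ℝ, Real.exp (-(x ^ 2 / 2)) * Real.exp (-(θ * x ^ 2 / 2)) =
        Real.exp (-((1 + θ) / 2) * x ^ 2) := fun x => by rw [← Real.exp_add]; congr 1; ring
    simp_rw [h1]
    rw [integral_gaussian, show π / ((1 + θ) / 2) = 2 * π / (1 + θ) by field_simp,
      Real.sqrt_div (by positivity : (0 : ℝ) ≤ 2 * π), div_eq_mul_inv, ← mul_assoc,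
      inv_mul_cancel₀ hsq.ne', one_mul]
  rw [← hval]
  refine Tendsto.const_mul _ ?_
  refine tendsto_integral_of_dominated_convergence (fun x => Real.exp (-(x ^ 2 / 2))) ?_
    integrable_exp_neg_sq_half ?_ ?_
  · intro m; exact Continuous.aestronglyMeasurable (by fun_prop)
  · intro m
    refine ae_of_all _ fun x => ?_
    rw [Real.norm_eq_abs, abs_mul, abs_of_pos (Real.exp_pos _), abs_pow]
    exact mul_le_of_le_one_right (Real.exp_pos _).le (pow_le_one₀ (abs_nonneg _) (Real.abs_cos_le_one _))
  · refine ae_of_all _ fun x => ?_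
    have hc : Tendsto (fun m : ℕ => (m : ℝ) * Real.sqrt (lam m) ^ 2) atTop (𝓝 θ) :=
      h.congr fun m => by rw [Real.sq_sqrt (h0 m)]
    exact (tendsto_cos_mul_pow hc x).const_mul _

end Edwards2D

end Literature.Barriers.CriticalPhenomena
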